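import Literature.MathematicalPhysics.QuantumFieldTheory.Balaban1983to89.B16Ineq382TreeGauge

/-!
# `Balaban1983to89.B16Ineq178TreeGauge` — T. Bałaban, *Large field renormalization. II. Localization, exponentiation, and bounds for the 𝐑 operation*, Commun. Math. Phys. **122** (1989) 355–392 [Balaban1989LargeFieldII], (1.78) p. 383: the one-bond tree-gauge Poincaré inequality `|B(b)|² ≦ 6(d+3)(100M(L+1)N^{β₀}R_j)^{d+2} Σ_{p′} |(∂B)(p′)|²` — PROVED at object level in the generalized axial gauge of [Balaban1989LargeFieldI] p. 196 on a rectangular annulus of `ℤ^d` (the carrier of `B15TreeGauge196*` / `B16Ineq382*`), for real- and 𝔤-valued `B`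

statement-level skeleton of published theorems with citation tags; proofs where landed; nothing here is a claim about the Yang–Mills mass gap

PDF held: `paper:balaban1989-cmp122-large-field-ii` (journal page = PDF page + 354; p. 383 = PDF p. 29, re-read AS AN
IMAGE for this file: `run/shared/lean/pub/pub-balaban/b2b-balaban-ref1/pages/1989-cmp122-large-field-II/…-p029-x2.png`;
p. 358 (1.8) = PDF p. 4, `…-p004-x2.png`); `paper:balaban1989-cmp122-large-field-i` pp. 195–196 (the gauge; typed by
seat p26 in `B15TreeGauge196`).

WHAT IS REPRODUCED (mega-formalization `lit-balaban`, HOME `run/shared/lean/pub/lit-balaban/`, reader/typer seat r13 =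
the B16 §1 display-level owner, generation 5; SKELETON row **B16.Eq1.78**, decl of record `B16Sect1Kernels.Ineq178`
(typed p238958, the arithmetic shape `nb ≤ 6(d+3)(100M(L+1)N^{β₀}R_j)^{d+2}·ndB`); consumer-cited locus F-T4-47 of the
T⁴ spine (rows B16.Eq1.77–1.79, "the one-bond large-field factor"); referee ref-5).  P. 383 (render re-read), verbatim:
*"For the quadratic form on the right-hand side we have an inequality similar to (1.8), but now we need a simpler
inequality. We have to bound one bond variable |B(b)|² by the quadratic form. By the same remark as in the case of the
inequality (1.8), we get |B(b)|² ≦ 6(d + 3)(100M(L + 1)N^{β₀}R_j)^{d+2} Σ_{p′∈𝐁₀∩Ω″~_{h+1}} |(∂B)(p′)|², (1.78) for a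
bond b ∈ 𝐁₀ ∩ Ω″~_{h+1}."*  The "remark in the case of (1.8)" (p. 358): *"Using the fact that Λ is a rectangular
parallelepiped contained in a cube of the size 100M, and that G₀ determines the axial gauge in Λ … The inequality is
also much more general, holding for general domains Λ, and graphs G₀ fixing a gauge in Λ, but with different
constants."*  Here the gauge is `δ_{T₀}(B)` of the 𝐑′-integration region `𝐁₀` ([Balaban1989LargeFieldI] §1, before
(1.82)): the generalized axial gauge of [I] p. 196 on the nested rectangular parallelepipeds, whose side is bounded by
condition (i) of [I] p. 177 ("contained in a cube of the size 100MR_k", here `100MR_{j−N+1} ≦ 100M(L+1)N^{β₀}R_j`).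

THE THEOREM (kind «model-instance»: ONE annulus `P₁ ∖ P₂ = ann lo hi lo' hi'` of `ℤ^{n+3}` with the contours `Γ_{y,x}`
of [I] p. 196, exactly the carrier on which seat p26 proved the case-1 estimate of p. 382 for group-valued fields,
`B16Ineq382.norm_bond_sub_one_le`).  For a REAL bond function `B` on `ℤ^{n+3}` in the tree gauge — its line sums along
the contours `Γ_{y,x}`, `x ∈ P₁∖P₂`, vanish (`lineSum B lo (contour lo hi τ x) = 0`; implied by the printed "bond
variables equal to 1 [`B = 0`] for bonds belonging to the tree graph", `lineSum_eq_zero_of_forall_step`) — and every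
bond `b = ⟨x, x + e_μ⟩` with both ends in `P₁∖P₂`:
* `abs_bond_le` (ℓ^∞ Stokes form): `|B(b)| ≤ (5W² + dW)·s` whenever `|(∂B)(p′)| ≤ s` for the plaquettes `p′` with
  corners in `P₁∖P₂` (`W + 1` = sites per side of `P₁`, `d = n + 3`);
* `bond_sq_le` (ℓ² form): `|B(b)|² ≤ (5W² + dW)² Σ_{p′ ⊂ P₁∖P₂} |(∂B)(p′)|²` (`annPlaqSum`, each plaquette once);
* **`ineq178`** = (1.78) AS TYPED: `B16Sect1Kernels.Ineq178 (B(b)²) (Σ_{p′}|(∂B)(p′)|²) M L N^{β₀} R_j (n+3)` whenever the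
  sides have `W + 1 ≤ 100M(L+1)N^{β₀}R_j` sites and `d ≤ 100M(L+1)N^{β₀}R_j` — the printed constant is met with room:
  `(5W² + dW)² ≤ 36D⁴ ≤ 6(d+3)D^{d+2}` for `D ≥ W + 1`, `D ≥ d ≥ 3`;
* `ineq178_vec`: the same for 𝔤-valued `B` in the coordinates of an orthonormal basis (`|B(b)|² = Σ_a B_a(b)²`,
  `(∂B)_a = ∂(B_a)`), which is the row's reading; `ineq178_gaugeFixed`: for ANY `B`, the additively gauge-fixed field
  `B^λ`, `λ(x) = lineSum B lo Γ_{y,x}` (p. 381 "v(x) = V(Γ_{y,x})"), satisfies (1.78).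

THE PROOF (how "the same remark" is discharged here).  No additive Stokes theory is re-developed: the real field is
embedded into p26's `U1 ℂ`-valued framework by the one-parameter family `V_t(b) = e^{itB(b)} ∈ U(1)` (`phaseField`).
`V_t` satisfies the axial gauge conditions (`e^{it·0} = 1`), its plaquette variables are `e^{it(∂B)(p′)}`, within
`|t|·s` of `1` (`Real.norm_exp_I_mul_ofReal_sub_one_le`), so `B16Ineq382.norm_bond_sub_one_le` (the thin strips,
rectangles and shifted rectangles of p. 382) gives `‖e^{itB(b)} − 1‖ ≤ (5W² + dW)|t|s` for every `t`; the derivative of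
`t ↦ e^{itB(b)}` at `t = 0` is `iB(b)`, and the bound passes to the limit of the difference quotients
(`abs_le_of_norm_cexp_sub_one_le`).  Cauchy–Schwarz is replaced by `|(∂B)(p′)| ≤ (Σ|(∂B)|²)^{1/2}` plaquette-wise.

HONEST SCOPE / DEVIATIONS.  (1) Model = one annulus of the nested sequence (as `B16Ineq382TreeGauge`; the external bonds
joining the annuli into `T₀`, the Faddeev–Popov `δ_{T₀}`, and the intersection with `Ω″~_{h+1}` are not modelled);
`d ≥ 3` needed (`d = n + 3`; print `d = 4`).  (2) The sum on the right is over the plaquettes with all four corners in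
`P₁∖P₂` ("p′ ∈ 𝐁₀ ∩ Ω″~_{h+1}" read as the plaquettes of the region, as in (1.8) "p ∈ Λ").  (3) The print derives no
constant; `6(d+3)(·)^{d+2}` is met, not explained.  (4) (1.77), the selection of the large bond and the factor
`exp(−R_j^{−d−5}p₁²(g_j))` are r13's `B16Sect1Kernels` §3/§6 arithmetic, untouched.  Every declaration is a definition
with a body or a proved theorem; nothing of [IV]/[V] is asserted.  Unit `lit-balaban-r13`
(literature-prover-lit-balaban-r13-g5-0).
-/

noncomputable section

open scoped BigOperators Topology
open Complex (I)
open Filter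

namespace Literature.MathematicalPhysics.QuantumFieldTheory.Balaban1983to89.B16Ineq178

open B7Prop1Explicit B8Lemma1NonAbelian B15TreeGauge196 B16Ineq382

-- `Site` alone would resolve to the torus sites of `Setup.lean`: re-export the `ℤ^d` sites (as `B16Ineq382`).
export B7Prop1Explicit (Site)

variable {d : ℕ}

/-! ## §1 Parallel transport through a group homomorphism; gauge-trivial words -/

section Hom

variable {G H : Type*} [Group G] [Group H]

/-- A homomorphism of the gauge group acts letter by letter on (9) of [Balaban1985Averaging]. [folklore] -/
private theorem stepHol_map (φ : G →* H) (V : Site d → Fin d → G) (x : Site d) (l : Letter d) :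
    stepHol (fun y ν => φ (V y ν)) x l = φ (stepHol V x l) := by
  unfold stepHol
  split_ifs <;> simp

/-- `V ↦ φ ∘ V` commutes with parallel transport: `(φ∘V)(Γ) = φ(V(Γ))`. [folklore] -/
private theorem hol_map (φ : G →* H) (V : Site d → Fin d → G) :
    ∀ (x : Site d) (w : List (Letter d)), hol (fun y ν => φ (V y ν)) x w = φ (hol V x w)
  | x, [] => by simp
  | x, l :: w => by rw [hol_cons, hol_cons, map_mul, stepHol_map, hol_map φ V (x + l.vec) w]

/-- A word all of whose bond variables are `1` has parallel transport `1` (p. 196 [I]: "putting the bond variables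
equal to 1 for bonds belonging to the tree graph" ⇒ the gauge conditions along the contours). [folklore] -/
private theorem hol_eq_one_of_forall_step (V : Site d → Fin d → G) :
    ∀ (x : Site d) (w : List (Letter d)),
      (∀ (w₁ : List (Letter d)) (l : Letter d) (w₂ : List (Letter d)), w = w₁ ++ l :: w₂ →
        stepHol V (x + disp w₁) l = 1) → hol V x w = 1
  | _, [], _ => rfl
  | x, l :: w, h => by
    have h0 : stepHol V x l = 1 := by simpa using h [] l w (by simp)
    rw [hol_cons, h0, one_mul]
    exact hol_eq_one_of_forall_step V (x + l.vec) w fun w₁ l' w₂ hw => by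
      have := h (l :: w₁) l' w₂ (by simp [hw])
      simpa [add_assoc] using this

end Hom

/-! ## §2 Real bond functions: line sums `B(Γ)` and the plaquette variable `(∂B)(p)` -/

section Scalar

/-- A real (𝔤-coordinate) bond function as a `Multiplicative ℝ`-valued lattice gauge field, so that the word calculus
(9) of [Balaban1985Averaging] (`B7Prop1Explicit.hol`) computes its line sums. [cite: Balaban1989LargeFieldII, (1.78) p.383] -/
def mulField (B : Site d → Fin d → ℝ) : Site d → Fin d → Multiplicative ℝ := fun x μ => Multiplicative.ofAdd (B x μ)

/-- The line sum `B(Γ) = Σ_{b∈Γ} ±B(b)` of `B` along the word `w` spelled from `x`. [cite: Balaban1989LargeFieldII, (1.78) p.383] -/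
def lineSum (B : Site d → Fin d → ℝ) (x : Site d) (w : List (Letter d)) : ℝ :=
  Multiplicative.toAdd (hol (mulField B) x w)

/-- The plaquette variable `(∂B)(p′)` of (1.78) for the plaquette with lowest corner `z` spanned by `e_κ, e_μ`:
`B(z,z+e_κ) + B(z+e_κ,z+e_κ+e_μ) − B(z+e_μ,z+e_μ+e_κ) − B(z,z+e_μ)`. [cite: Balaban1989LargeFieldII, (1.78) p.383] -/
def curl (B : Site d → Fin d → ℝ) (z : Site d) (κ μ : Fin d) : ℝ :=
  B z κ + B (z + e κ) μ - B (z + e μ) κ - B z μ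

variable (B : Site d → Fin d → ℝ)

/-- `(∂B)` is antisymmetric in the two directions. [cite: Balaban1989LargeFieldII, (1.78) p.383] -/
theorem curl_swap (z : Site d) (κ μ : Fin d) : curl B z μ κ = -curl B z κ μ := by
  unfold curl; ring

/-- The line sum around the plaquette contour `∂p` IS `(∂B)(p)`. [cite: Balaban1989LargeFieldII, (1.78) p.383] -/
theorem lineSum_plaqWord (z : Site d) (κ μ : Fin d) : lineSum B z (plaqWord κ μ) = curl B z κ μ := by
  have h1 : z + e κ + e μ - e κ = z + e μ := by abel
  have h2 : z + e κ + e μ + -e κ - e μ = z := by abel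
  simp only [lineSum, mulField, plaqWord, hol_cons, hol_nil, mul_one, stepHol_true, stepHol_false,
    Letter.vec_true, Letter.vec_false, h1, h2, toAdd_mul, toAdd_inv, toAdd_ofAdd, curl]
  ring

/-- A word all of whose bonds carry `B = 0` has line sum `0` — the printed gauge condition "bond variables equal to 1
for bonds belonging to the tree graph" ([I] p. 196) implies the vanishing of `B(Γ_{y,x})` used below. [cite: Balaban1989LargeFieldII, (1.78) p.383] -/
theorem lineSum_eq_zero_of_forall_step (x : Site d) (w : List (Letter d))
    (h : ∀ (w₁ : List (Letter d)) (l : Letter d) (w₂ : List (Letter d)), w = w₁ ++ l :: w₂ →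
      (if l.2 then B (x + disp w₁) l.1 else B (x + disp w₁ + l.vec) l.1) = 0) :
    lineSum B x w = 0 := by
  have : hol (mulField B) x w = 1 := hol_eq_one_of_forall_step _ x w fun w₁ l w₂ hw => by
    have h' := h w₁ l w₂ hw
    unfold stepHol mulField
    split_ifs at h' ⊢ <;> simp [h']
  rw [lineSum, this, toAdd_one]

/-! ## §3 The embedding `B ↦ V_t = e^{itB}` into `U(1) ⊂ U1 ℂ` -/

/-- `e^{iθ}` as a unit of `ℂ`. [folklore] -/
def uexp (θ : ℝ) : ℂˣ where
  val := Complex.exp (I * θ)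
  inv := Complex.exp (-(I * θ))
  val_inv := by rw [← Complex.exp_add, add_neg_cancel, Complex.exp_zero]
  inv_val := by rw [← Complex.exp_add, neg_add_cancel, Complex.exp_zero]

/-- `uexp θ = e^{iθ}`. [cite: Balaban1989LargeFieldII, (1.78) p.383] -/
@[simp] theorem uexp_val (θ : ℝ) : ((uexp θ : ℂˣ) : ℂ) = Complex.exp (I * θ) := rfl

/-- `e^{i0} = 1`. [cite: Balaban1989LargeFieldII, (1.78) p.383] -/
theorem uexp_zero : uexp 0 = 1 := Units.ext (by simp)

/-- `e^{i(a+b)} = e^{ia}e^{ib}`. [cite: Balaban1989LargeFieldII, (1.78) p.383] -/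
theorem uexp_add (a b : ℝ) : uexp (a + b) = uexp a * uexp b :=
  Units.ext (by simp only [uexp_val, Units.val_mul, Complex.ofReal_add, mul_add, Complex.exp_add])

/-- `e^{−ia} = (e^{ia})⁻¹`. [cite: Balaban1989LargeFieldII, (1.78) p.383] -/
theorem uexp_neg (a : ℝ) : uexp (-a) = (uexp a)⁻¹ :=
  eq_inv_of_mul_eq_one_left (by rw [← uexp_add, neg_add_cancel, uexp_zero])

/-- `|e^{iθ}| = 1`. [cite: Balaban1989LargeFieldII, (1.78) p.383] -/
theorem norm_uexp (θ : ℝ) : ‖((uexp θ : ℂˣ) : ℂ)‖ = 1 := by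
  rw [uexp_val, mul_comm]; exact Complex.norm_exp_ofReal_mul_I θ

/-- `U(1) ⊂ U1 ℂ` (the group of `B7Prop1Explicit`: `‖u‖ ≤ 1`, `‖u⁻¹‖ ≤ 1`). [cite: Balaban1989LargeFieldII, (1.78) p.383] -/
theorem uexp_mem_U1 (θ : ℝ) : uexp θ ∈ U1 ℂ := by
  rw [mem_U1, ← uexp_neg, norm_uexp, norm_uexp]
  exact ⟨le_rfl, le_rfl⟩

/-- `a ↦ e^{ita}` as a homomorphism `Multiplicative ℝ →* ℂˣ`. [folklore] -/
def uexpHom (t : ℝ) : Multiplicative ℝ →* ℂˣ where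
  toFun a := uexp (t * Multiplicative.toAdd a)
  map_one' := by rw [toAdd_one, mul_zero, uexp_zero]
  map_mul' a b := by rw [toAdd_mul, mul_add, uexp_add]

/-- **The one-parameter family `V_t(b) = e^{itB(b)}`** of `U(1)`-valued lattice gauge fields attached to the real bond
function `B`. [cite: Balaban1989LargeFieldII, (1.78) p.383] -/
def phaseField (t : ℝ) (B : Site d → Fin d → ℝ) : Site d → Fin d → ℂˣ := fun x μ => uexp (t * B x μ)

/-- `V_t(b) = e^{itB(b)}`. [cite: Balaban1989LargeFieldII, (1.78) p.383] -/
@[simp] theorem phaseField_val (t : ℝ) (x : Site d) (μ : Fin d) :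
    ((phaseField t B x μ : ℂˣ) : ℂ) = Complex.exp (I * ((t * B x μ : ℝ) : ℂ)) := rfl

/-- Parallel transport of `V_t` = `e^{it·(line sum of B)}`. [cite: Balaban1989LargeFieldII, (1.78) p.383] -/
theorem hol_phaseField (t : ℝ) (x : Site d) (w : List (Letter d)) :
    hol (phaseField t B) x w = uexp (t * lineSum B x w) := by
  have hφ : phaseField t B = fun y ν => uexpHom t (mulField B y ν) := rfl
  rw [hφ, hol_map]
  rfl

/-- The hypothesis of (1.78)'s right-hand side, LOCALIZED to a set `A` of sites (the additive counterpart of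
`B16Ineq382.PlaqSmallOn`): `|(∂B)(p′)| ≤ s` for every plaquette `p′` with its four corners in `A`. [cite: Balaban1989LargeFieldII, (1.78) p.383] -/
def CurlBoundOn (A : Set (Site d)) (B : Site d → Fin d → ℝ) (s : ℝ) : Prop :=
  ∀ (z : Site d) (κ μ : Fin d), κ ≠ μ → z ∈ A → z + e κ ∈ A → z + e μ ∈ A → z + e κ + e μ ∈ A →
    |curl B z κ μ| ≤ s

/-- The plaquette variables of `V_t` are `e^{it(∂B)(p′)}`, within `|t|·s` of `1`. [cite: Balaban1989LargeFieldII, (1.78) p.383] -/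
theorem plaqSmallOn_phaseField {A : Set (Site d)} {s : ℝ} (hB : CurlBoundOn A B s) (t : ℝ) :
    B16Ineq382.PlaqSmallOn A (phaseField t B) (|t| * s) := by
  intro z κ μ hκμ h1 h2 h3 h4
  rw [hol_phaseField, lineSum_plaqWord, uexp_val]
  calc ‖Complex.exp (I * ((t * curl B z κ μ : ℝ) : ℂ)) - 1‖ ≤ ‖t * curl B z κ μ‖ :=
        Real.norm_exp_I_mul_ofReal_sub_one_le
    _ = |t| * |curl B z κ μ| := by rw [Real.norm_eq_abs, abs_mul]
    _ ≤ |t| * s := mul_le_mul_of_nonneg_left (hB z κ μ hκμ h1 h2 h3 h4) (abs_nonneg t)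

/-- **The limit `t → 0`**: if `‖e^{itβ} − 1‖ ≤ |t|·c` for all `t ≠ 0`, then `|β| ≤ c` (the derivative of `t ↦ e^{itβ}`
at `0` is `iβ`; the bound passes to the limit of the difference quotients). [folklore] -/
private theorem abs_le_of_norm_cexp_sub_one_le {β c : ℝ}
    (h : ∀ t : ℝ, t ≠ 0 → ‖Complex.exp (I * ((t * β : ℝ) : ℂ)) - 1‖ ≤ |t| * c) : |β| ≤ c := by
  have hd : HasDerivAt (fun t : ℝ => Complex.exp (I * ((t * β : ℝ) : ℂ))) (I * (β : ℂ)) 0 := by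
    have h1 : HasDerivAt (fun t : ℝ => ((t * β : ℝ) : ℂ)) β 0 := (hasDerivAt_mul_const β).ofReal_comp
    simpa using (h1.const_mul I).cexp
  have hn := hd.tendsto_slope_zero.norm
  have hI : ‖I * (β : ℂ)‖ = |β| := by simp
  rw [hI] at hn
  refine le_of_tendsto hn ?_
  filter_upwards [self_mem_nhdsWithin] with t ht
  have ht0 : t ≠ 0 := ht
  have h0 : Complex.exp (I * (((0 : ℝ) * β : ℝ) : ℂ)) = 1 := by simp
  show ‖t⁻¹ • (Complex.exp (I * (((0 + t) * β : ℝ) : ℂ)) - Complex.exp (I * (((0 : ℝ) * β : ℝ) : ℂ)))‖ ≤ c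
  rw [h0, zero_add, norm_smul, norm_inv, Real.norm_eq_abs]
  calc |t|⁻¹ * ‖Complex.exp (I * ((t * β : ℝ) : ℂ)) - 1‖ ≤ |t|⁻¹ * (|t| * c) :=
        mul_le_mul_of_nonneg_left (h t ht0) (inv_nonneg.mpr (abs_nonneg t))
    _ = c := by rw [← mul_assoc, inv_mul_cancel₀ (abs_ne_zero.mpr ht0), one_mul]

end Scalar

/-! ## §4 (1.78) on the annulus `P₁ ∖ P₂` of [I] p. 196 -/

variable {n : ℕ} {lo hi lo' hi' : Site (n + 3)} {τ : ℤ} {W : ℕ}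

/-- **`V_t` is in the printed situation of p. 381**: for a real `B` in the tree gauge of [I] p. 196 on `P₁∖P₂` with
`|(∂B)(p′)| ≤ s` there, `V_t = e^{itB}` satisfies `B16Ineq382.Case1Hyp` with `ε = |t|s`. [cite: Balaban1989LargeFieldII, (1.78) p.383] -/
theorem case1Hyp_phaseField (hG : Geom lo hi lo' hi' τ) (hW : ∀ κ, hi κ - lo κ ≤ W)
    {B : Site (n + 3) → Fin (n + 3) → ℝ}
    (hgauge : ∀ x ∈ ann lo hi lo' hi', lineSum B lo (contour lo hi τ x) = 0) {s : ℝ} (hs : 0 ≤ s)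
    (hcurl : CurlBoundOn (ann lo hi lo' hi') B s) (t : ℝ) :
    Case1Hyp lo hi lo' hi' τ W (phaseField t B) (|t| * s) where
  geom := hG
  width := hW
  unit := fun x κ => uexp_mem_U1 _
  eps_nonneg := mul_nonneg (abs_nonneg t) hs
  plaq := plaqSmallOn_phaseField B hcurl t
  gauge := fun x hx => by rw [hol_phaseField, hgauge x hx, mul_zero, uexp_zero]

/-- **(1.78), ℓ^∞ (Stokes) form**: in the tree gauge of [I] p. 196 on the annulus `P₁∖P₂` (sides of `P₁` of at most
`W + 1` sites, `d = n + 3`), if `|(∂B)(p′)| ≤ s` for the plaquettes `p′` with corners in `P₁∖P₂`, then every bond `b`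
with both ends in `P₁∖P₂` has `|B(b)| ≤ (5W² + dW)·s` — "the same remark as in the case of the inequality (1.8)" via
p26's surfaces (`B16Ineq382.norm_bond_sub_one_le`) applied to `e^{itB}` and `t → 0`. [cite: Balaban1989LargeFieldII, (1.78) p.383] -/
theorem abs_bond_le (hG : Geom lo hi lo' hi' τ) (hW : ∀ κ, hi κ - lo κ ≤ W)
    {B : Site (n + 3) → Fin (n + 3) → ℝ}
    (hgauge : ∀ x ∈ ann lo hi lo' hi', lineSum B lo (contour lo hi τ x) = 0) {s : ℝ} (hs : 0 ≤ s)
    (hcurl : CurlBoundOn (ann lo hi lo' hi') B s) {x : Site (n + 3)} {μ : Fin (n + 3)}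
    (hx : x ∈ ann lo hi lo' hi') (hx' : x + e μ ∈ ann lo hi lo' hi') :
    |B x μ| ≤ (5 * (W : ℝ) ^ 2 + (n + 3) * W) * s := by
  refine abs_le_of_norm_cexp_sub_one_le fun t _ => ?_
  have h := norm_bond_sub_one_le (case1Hyp_phaseField hG hW hgauge hs hcurl t) hx hx'
  rw [phaseField_val] at h
  calc _ ≤ _ := h
    _ = |t| * ((5 * (W : ℝ) ^ 2 + (n + 3) * W) * s) := by ring

/-! ## §5 The quadratic form `Σ_{p′} |(∂B)(p′)|²` and (1.78) as printed -/

open Classical in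
/-- The plaquettes `p′` of the annulus (all four corners in `P₁∖P₂`), each recorded once as `(z, κ, μ)` with lowest
corner `z` and directions `κ < μ` — the index set of "Σ_{p′∈𝐁₀∩Ω″~_{h+1}}" in the model. [cite: Balaban1989LargeFieldII, (1.78) p.383] -/
def annPlaq (lo hi lo' hi' : Site (n + 3)) : Finset (Site (n + 3) × Fin (n + 3) × Fin (n + 3)) :=
  (Finset.Icc lo hi ×ˢ (Finset.univ : Finset (Fin (n + 3) × Fin (n + 3)))).filter fun p =>
    p.2.1 < p.2.2 ∧ p.1 ∈ ann lo hi lo' hi' ∧ p.1 + e p.2.1 ∈ ann lo hi lo' hi' ∧ p.1 + e p.2.2 ∈ ann lo hi lo' hi' ∧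
      p.1 + e p.2.1 + e p.2.2 ∈ ann lo hi lo' hi'

/-- Membership in `annPlaq`. [cite: Balaban1989LargeFieldII, (1.78) p.383] -/
theorem mem_annPlaq {z : Site (n + 3)} {κ μ : Fin (n + 3)} :
    (z, κ, μ) ∈ annPlaq lo hi lo' hi' ↔ κ < μ ∧ z ∈ ann lo hi lo' hi' ∧ z + e κ ∈ ann lo hi lo' hi' ∧
      z + e μ ∈ ann lo hi lo' hi' ∧ z + e κ + e μ ∈ ann lo hi lo' hi' := by
  classical
  simp only [annPlaq, Finset.mem_filter, Finset.mem_product, Finset.mem_univ, and_true, Finset.mem_Icc,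
    and_iff_right_iff_imp]
  rintro ⟨-, hz, -⟩
  exact hz.1

/-- **The quadratic form of (1.78)**: `Σ_{p′ ⊂ P₁∖P₂} |(∂B)(p′)|²`. [cite: Balaban1989LargeFieldII, (1.78) p.383] -/
def annPlaqSum (lo hi lo' hi' : Site (n + 3)) (B : Site (n + 3) → Fin (n + 3) → ℝ) : ℝ :=
  ∑ p ∈ annPlaq lo hi lo' hi', curl B p.1 p.2.1 p.2.2 ^ 2

/-- `Σ|(∂B)|² ≥ 0`. [cite: Balaban1989LargeFieldII, (1.78) p.383] -/
theorem annPlaqSum_nonneg (B : Site (n + 3) → Fin (n + 3) → ℝ) : 0 ≤ annPlaqSum lo hi lo' hi' B :=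
  Finset.sum_nonneg fun _ _ => sq_nonneg _

/-- Plaquette-wise, `|(∂B)(p′)| ≤ (Σ_{p″}|(∂B)(p″)|²)^{1/2}` for every plaquette `p′` of the annulus (either
orientation) — the replacement for Cauchy–Schwarz in the one-bond inequality. [cite: Balaban1989LargeFieldII, (1.78) p.383] -/
theorem curlBoundOn_sqrt (B : Site (n + 3) → Fin (n + 3) → ℝ) :
    CurlBoundOn (ann lo hi lo' hi') B (Real.sqrt (annPlaqSum lo hi lo' hi' B)) := by
  have key : ∀ (z : Site (n + 3)) (κ μ : Fin (n + 3)), κ < μ → z ∈ ann lo hi lo' hi' →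
      z + e κ ∈ ann lo hi lo' hi' → z + e μ ∈ ann lo hi lo' hi' → z + e κ + e μ ∈ ann lo hi lo' hi' →
      |curl B z κ μ| ≤ Real.sqrt (annPlaqSum lo hi lo' hi' B) := by
    intro z κ μ hκμ h1 h2 h3 h4
    rw [← Real.sqrt_sq_eq_abs]
    refine Real.sqrt_le_sqrt ?_
    have hmem : (z, κ, μ) ∈ annPlaq lo hi lo' hi' := mem_annPlaq.mpr ⟨hκμ, h1, h2, h3, h4⟩
    exact Finset.single_le_sum (f := fun p => curl B p.1 p.2.1 p.2.2 ^ 2) (fun _ _ => sq_nonneg _) hmem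
  intro z κ μ hκμ h1 h2 h3 h4
  rcases lt_or_gt_of_ne hκμ with hlt | hgt
  · exact key z κ μ hlt h1 h2 h3 h4
  · rw [← neg_neg (curl B z κ μ), ← curl_swap, abs_neg]
    exact key z μ κ hgt h1 h3 h2 (by rwa [add_right_comm])

/-- **(1.78), ℓ² form with the surface constant**: `|B(b)|² ≤ (5W² + dW)² Σ_{p′ ⊂ P₁∖P₂} |(∂B)(p′)|²` for every bond
`b` of the annulus, `B` in the tree gauge. [cite: Balaban1989LargeFieldII, (1.78) p.383] -/
theorem bond_sq_le (hG : Geom lo hi lo' hi' τ) (hW : ∀ κ, hi κ - lo κ ≤ W)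
    {B : Site (n + 3) → Fin (n + 3) → ℝ}
    (hgauge : ∀ x ∈ ann lo hi lo' hi', lineSum B lo (contour lo hi τ x) = 0) {x : Site (n + 3)} {μ : Fin (n + 3)}
    (hx : x ∈ ann lo hi lo' hi') (hx' : x + e μ ∈ ann lo hi lo' hi') :
    B x μ ^ 2 ≤ (5 * (W : ℝ) ^ 2 + (n + 3) * W) ^ 2 * annPlaqSum lo hi lo' hi' B := by
  have h := abs_bond_le hG hW hgauge (Real.sqrt_nonneg _) (curlBoundOn_sqrt B) hx hx'
  have hC : (0 : ℝ) ≤ 5 * (W : ℝ) ^ 2 + (n + 3) * W := by positivity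
  calc B x μ ^ 2 = |B x μ| ^ 2 := (sq_abs _).symm
    _ ≤ ((5 * (W : ℝ) ^ 2 + (n + 3) * W) * Real.sqrt (annPlaqSum lo hi lo' hi' B)) ^ 2 :=
        pow_le_pow_left₀ (abs_nonneg _) h 2
    _ = _ := by rw [mul_pow, Real.sq_sqrt (annPlaqSum_nonneg B)]

/-- The printed constant is met: `(5W² + dW)² ≤ 6(d+3)D^{d+2}` when the sides have `W + 1 ≤ D` sites and `d ≤ D`
(`d = n + 3`). [cite: Balaban1989LargeFieldII, (1.78) p.383] -/
theorem surfaceConst_sq_le {D : ℝ} (hD : (W : ℝ) + 1 ≤ D) (hd : (n : ℝ) + 3 ≤ D) :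
    (5 * (W : ℝ) ^ 2 + (n + 3) * W) ^ 2 ≤ 6 * ((n + 3 : ℕ) + 3) * D ^ (n + 3 + 2) := by
  have hW : (0 : ℝ) ≤ W := Nat.cast_nonneg W
  have hn : (0 : ℝ) ≤ n := Nat.cast_nonneg n
  have hD1 : (1 : ℝ) ≤ D := by linarith
  have hC0 : (0 : ℝ) ≤ 5 * (W : ℝ) ^ 2 + (n + 3) * W := by positivity
  have ha : (W : ℝ) * W ≤ (D - 1) * (D - 1) := mul_self_le_mul_self hW (by linarith)
  have hb : ((n : ℝ) + 3) * W ≤ D * (D - 1) := mul_le_mul hd (by linarith) hW (by linarith)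
  have hC : 5 * (W : ℝ) ^ 2 + (n + 3) * W ≤ 6 * D ^ 2 := by nlinarith
  have h1 : (5 * (W : ℝ) ^ 2 + (n + 3) * W) ^ 2 ≤ (6 * D ^ 2) ^ 2 := pow_le_pow_left₀ hC0 hC 2
  have h2 : D ^ 4 ≤ D ^ (n + 3 + 2) := pow_le_pow_right₀ hD1 (by omega)
  have h3 : (36 : ℝ) ≤ 6 * ((n + 3 : ℕ) + 3) := by push_cast; linarith
  calc (5 * (W : ℝ) ^ 2 + (n + 3) * W) ^ 2 ≤ (6 * D ^ 2) ^ 2 := h1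
    _ = 36 * D ^ 4 := by ring
    _ ≤ 6 * ((n + 3 : ℕ) + 3) * D ^ (n + 3 + 2) := mul_le_mul h3 h2 (by positivity) (by positivity)

/-- **(1.78) AS TYPED, PROVED (real `B`)**: on the annulus `P₁∖P₂ ⊂ ℤ^{n+3}` of [I] p. 196 whose sides have at most
`100M(L+1)N^{β₀}R_j` sites (condition (i) of [I]: `Ω″ᶜ_{h+1}` "is contained in a cube of the size 100MR" with
`R_{j−N+1} ≦ (L+1)N^{β₀}R_j`) and `d = n + 3 ≤ 100M(L+1)N^{β₀}R_j`, every real bond function `B` in the tree gauge and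
every bond `b` with both ends in `P₁∖P₂` satisfy `B16Sect1Kernels.Ineq178 |B(b)|² (Σ_{p′}|(∂B)(p′)|²) M L N^{β₀} R_j d`,
i.e. `|B(b)|² ≦ 6(d+3)(100M(L+1)N^{β₀}R_j)^{d+2} Σ_{p′}|(∂B)(p′)|²`. [cite: Balaban1989LargeFieldII, (1.78) p.383] -/
theorem ineq178 (hG : Geom lo hi lo' hi' τ) {M L Nβ Rj : ℝ}
    (hD : ∀ κ, ((hi κ - lo κ : ℤ) : ℝ) + 1 ≤ 100 * M * (L + 1) * Nβ * Rj)
    (hd : (n : ℝ) + 3 ≤ 100 * M * (L + 1) * Nβ * Rj) {B : Site (n + 3) → Fin (n + 3) → ℝ}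
    (hgauge : ∀ x ∈ ann lo hi lo' hi', lineSum B lo (contour lo hi τ x) = 0) {x : Site (n + 3)} {μ : Fin (n + 3)}
    (hx : x ∈ ann lo hi lo' hi') (hx' : x + e μ ∈ ann lo hi lo' hi') :
    B16Sect1Kernels.Ineq178 (B x μ ^ 2) (annPlaqSum lo hi lo' hi' B) M L Nβ Rj (n + 3) := by
  unfold B16Sect1Kernels.Ineq178
  -- the uniform side bound `W` = the largest side of `P₁` (nonnegative since `x ∈ P₁`)
  obtain ⟨κ₀, -, hκ₀⟩ := Finset.exists_max_image Finset.univ (fun κ : Fin (n + 3) => hi κ - lo κ)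
    ⟨μ, Finset.mem_univ _⟩
  have hxb := (mem_box_iff.mp hx.1) κ₀
  have hW0 : 0 ≤ hi κ₀ - lo κ₀ := by linarith [hxb.1, hxb.2]
  set W : ℕ := (hi κ₀ - lo κ₀).toNat with hWdef
  have hWZ : ((W : ℕ) : ℤ) = hi κ₀ - lo κ₀ := Int.toNat_of_nonneg hW0
  have hW : ∀ κ, hi κ - lo κ ≤ W := fun κ => by rw [hWZ]; exact hκ₀ κ (Finset.mem_univ _)
  have hWR : (W : ℝ) + 1 ≤ 100 * M * (L + 1) * Nβ * Rj := by
    have : (W : ℝ) = ((hi κ₀ - lo κ₀ : ℤ) : ℝ) := by exact_mod_cast hWZ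
    rw [this]; exact hD κ₀
  exact (bond_sq_le hG hW hgauge hx hx').trans
    (mul_le_mul_of_nonneg_right (surfaceConst_sq_le hWR hd) (annPlaqSum_nonneg B))

/-- **(1.78) AS TYPED, PROVED — 𝔤-valued `B`** in the coordinates `a : Fin m` of an orthonormal basis of 𝔤
(`|B(b)|² = Σ_a B_a(b)²`, `(∂B)_a = ∂(B_a)`, each coordinate in the tree gauge), which is the row's reading:
`|B(b)|² ≦ 6(d+3)(100M(L+1)N^{β₀}R_j)^{d+2} Σ_{p′}|(∂B)(p′)|²`. [cite: Balaban1989LargeFieldII, (1.78) p.383] -/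
theorem ineq178_vec (hG : Geom lo hi lo' hi' τ) {M L Nβ Rj : ℝ}
    (hD : ∀ κ, ((hi κ - lo κ : ℤ) : ℝ) + 1 ≤ 100 * M * (L + 1) * Nβ * Rj)
    (hd : (n : ℝ) + 3 ≤ 100 * M * (L + 1) * Nβ * Rj) {m : ℕ} {B : Site (n + 3) → Fin (n + 3) → Fin m → ℝ}
    (hgauge : ∀ a, ∀ x ∈ ann lo hi lo' hi', lineSum (fun z ν => B z ν a) lo (contour lo hi τ x) = 0)
    {x : Site (n + 3)} {μ : Fin (n + 3)} (hx : x ∈ ann lo hi lo' hi') (hx' : x + e μ ∈ ann lo hi lo' hi') :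
    B16Sect1Kernels.Ineq178 (∑ a, B x μ a ^ 2)
      (∑ p ∈ annPlaq lo hi lo' hi', ∑ a, curl (fun z ν => B z ν a) p.1 p.2.1 p.2.2 ^ 2) M L Nβ Rj (n + 3) := by
  have hcomp := fun a : Fin m => ineq178 hG hD hd (hgauge a) hx hx'
  unfold B16Sect1Kernels.Ineq178 at hcomp ⊢
  calc ∑ a, B x μ a ^ 2
      ≤ ∑ a, 6 * ((n + 3 : ℕ) + 3 : ℝ) * (100 * M * (L + 1) * Nβ * Rj) ^ (n + 3 + 2) *
          annPlaqSum lo hi lo' hi' (fun z ν => B z ν a) := Finset.sum_le_sum fun a _ => hcomp a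
    _ = _ := by rw [← Finset.mul_sum]; unfold annPlaqSum; rw [Finset.sum_comm]

/-! ## §6 Any field after the additive gauge fixing `λ(x) = B(Γ_{y,x})` (p. 381 "v(x) = V(Γ_{y,x})") -/

/-- The additive gauge transformation `B^λ(x, x+e_μ) = λ(x) + B(x, x+e_μ) − λ(x+e_μ)`. [cite: Balaban1989LargeFieldII, (1.78) p.383] -/
def addGaugeAct (lam : Site d → ℝ) (B : Site d → Fin d → ℝ) : Site d → Fin d → ℝ :=
  fun x μ => lam x + B x μ - lam (x + e μ)

/-- `B^λ` is the multiplicative gauge action `gaugeAct` read additively. [cite: Balaban1989LargeFieldII, (1.78) p.383] -/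
theorem mulField_addGaugeAct (lam : Site d → ℝ) (B : Site d → Fin d → ℝ) :
    mulField (addGaugeAct lam B) = gaugeAct (fun x => Multiplicative.ofAdd (lam x)) (mulField B) := by
  funext x μ
  simp only [mulField, addGaugeAct, gaugeAct, ofAdd_add, ofAdd_sub, div_eq_mul_inv]

/-- A gauge transformation does not change the plaquette variables `(∂B)(p′)`. [cite: Balaban1989LargeFieldII, (1.78) p.383] -/
theorem curl_addGaugeAct (lam : Site d → ℝ) (B : Site d → Fin d → ℝ) (z : Site d) (κ μ : Fin d) :
    curl (addGaugeAct lam B) z κ μ = curl B z κ μ := by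
  simp only [curl, addGaugeAct, add_right_comm (z) (e μ) (e κ)]
  ring

/-- **The gauge fixing of p. 381 for `B`**: with `λ(x) = B(Γ_{y,x})`, the field `B^λ` has vanishing line sums along
all the contours `Γ_{y,x}` (`B15TreeGauge196.hol_treeGauge_contour` read additively). [cite: Balaban1989LargeFieldII, (1.78) p.383] -/
theorem lineSum_addGaugeAct_contour (B : Site (n + 3) → Fin (n + 3) → ℝ) (hlo : lo i0 ≤ τ) (x : Site (n + 3)) :
    lineSum (addGaugeAct (fun y => lineSum B lo (contour lo hi τ y)) B) lo (contour lo hi τ x) = 0 := by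
  have h := hol_treeGauge_contour (mulField B) (hi := hi) hlo x
  have hfn : (fun y => Multiplicative.ofAdd (lineSum B lo (contour lo hi τ y))) =
      treeGaugeFn (mulField B) lo hi τ := by
    funext y; simp only [lineSum, treeGaugeFn, ofAdd_toAdd]
  rw [lineSum, mulField_addGaugeAct, hfn, h, toAdd_one]

/-- **(1.78) for an arbitrary real `B` after gauge fixing**: the field `B₁ = B^λ`, `λ(x) = B(Γ_{y,x})`, satisfies
(1.78) on the annulus, with the SAME quadratic form (`∂B₁ = ∂B`). [cite: Balaban1989LargeFieldII, (1.78) p.383] -/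
theorem ineq178_gaugeFixed (hG : Geom lo hi lo' hi' τ) {M L Nβ Rj : ℝ}
    (hD : ∀ κ, ((hi κ - lo κ : ℤ) : ℝ) + 1 ≤ 100 * M * (L + 1) * Nβ * Rj)
    (hd : (n : ℝ) + 3 ≤ 100 * M * (L + 1) * Nβ * Rj) (B : Site (n + 3) → Fin (n + 3) → ℝ)
    {x : Site (n + 3)} {μ : Fin (n + 3)} (hx : x ∈ ann lo hi lo' hi') (hx' : x + e μ ∈ ann lo hi lo' hi') :
    B16Sect1Kernels.Ineq178 (addGaugeAct (fun y => lineSum B lo (contour lo hi τ y)) B x μ ^ 2)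
      (annPlaqSum lo hi lo' hi' B) M L Nβ Rj (n + 3) := by
  have h := ineq178 hG hD hd (fun y _ => lineSum_addGaugeAct_contour B hG.lo_le_tau y) hx hx'
  have hS : annPlaqSum lo hi lo' hi' (addGaugeAct (fun y => lineSum B lo (contour lo hi τ y)) B) =
      annPlaqSum lo hi lo' hi' B := by
    simp only [annPlaqSum, curl_addGaugeAct]
  rwa [hS] at h

end Literature.MathematicalPhysics.QuantumFieldTheory.Balaban1983to89.B16Ineq178
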